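import Summits.CriticalPhenomena.PercolationContinuityZ3.Theorems.PercNearOneGluingNoHeavyQuantWindowPairShallow
import HarnessLib

/-!
# QUANT lane R8, T-DEC: the window pair with transfer (`LawDec.SliceLawSW`, MID case `T + ag ≤ 2h`, `h′ = h`) — part 5:
# the shallow union (two vertical blocks × cells S-A/S-B/S-C) and THE WHOLE MID CASE

builds on p205010 (kernel theorem, internal audit signed; external expert review pending)

Support file (`--supports stmt-CriticalPhenomena-4575`), QUANT lane seat prim-quant-census-1 (gen 20), rung R8 of
`run/shared/lean/prim/quant/LADDER.md`.  Theorems only, standard axioms, no sorries.  Memo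
`run/shared/lean/prim/quant/prim-quant-census-1/SLICELAWSW-G20.md` §2–§3.

* `LawDec.windowPair_deep_X`, **`LawDec.windowPair_deep`** — emptiness of the fourth deep case and the union of the deep cells (part 3).
* **`LawDec.windowPair_shallow`** — every SHALLOW MID instance (`T + ag ≤ 2(l+a)`): the vertical block is `(R, λᵥ, π_a, γᵥ) =
  ((1−γ)(1−g) − B(1−ρᵥ)/ρᵥ, B/ρᵥ, 0, ρᵥ)` when the vertical pair `(l, l+a)` is compatible (`T + ag < 2l + a`, `ρᵥ = (T + ag − 2l)/a`),
  else `((1−γ)(1−g), 0, B, 0)`; then cells S-A / S-B / S-C of part 4 with the point-weight inequalities `poly_SAn/SAv`, `poly_SCn/SCv`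
  and the emptiness lemmas `windowPair_SXn` / `poly_SXv` (`…QuantWindowPairPoly`, `…QuantWindowPairShallow`).
* **`LawDec.windowPair_mid`** — EVERY MID instance of the window pair with `h′ = h`: for `0 < x < 1`, `x ≤ g < 1`, `a ≥ 1`, a low `l`,
  a light window absorber `h` (`T < l + h`, `l + a ≤ j′ < h + a`, `h ≤ j′`, `h ≤ M`, `T − 2l < x(h−l)`) with `T + ag ≤ 2h`, SOME transfer
  `0 ≤ t(1−g) ≤ γg` makes `(1−γ)(1−g)δ_l + (1−γ)gδ_{l+a} + (γ(1−g)+t(1−g))δ_h + (γg − t(1−g))δ_{h+a}` DEC(j′) at target `T + ag` on `{0..M+a}`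
  (`windowPair_deep` ∪ `windowPair_shallow`).

[this work].  Nothing here is cited as a published result.  The gluing rows served [cite: KozmaNitzan2024, Conjecture 3 (p. 15)];
product measure [cite: Grimmett1999, §1.3 p. 10].
-/

noncomputable section

namespace Summit.CriticalPhenomena.PercolationContinuityZ3.Theorems

namespace Quant

open Finset

namespace LawDec

/-- **emptiness of the fourth deep case**: if the row-0 pair is incompatible at the new target (`l + h ≤ T + ag`) then the giant
CAN take the row-0 low (`(1−γ)(1−g)x ≤ γg(1−x)`), so cell D-B applies (`poly_DX`). [this work] -/
theorem windowPair_deep_X (x g T γ : ℝ) (l a h : ℕ) (hx0 : 0 < x) (hx1 : x < 1) (hxg : x ≤ g) (hg1 : g < 1) (ha : 1 ≤ a)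
    (hlow : 2 * (l : ℝ) < T) (hcomp : T < (l : ℝ) + h) (hlight : T - 2 * (l : ℝ) < x * ((h : ℝ) - l))
    (hγ : γ = x ^ 2 + (1 - x) * ((T - 2 * (l : ℝ)) / ((h : ℝ) - l)))
    (hdeep : 2 * ((l : ℝ) + a) < T + (a : ℝ) * g) (hincompat0 : (l : ℝ) + h ≤ T + (a : ℝ) * g) :
    (1 - γ) * (1 - g) * x ≤ γ * g * (1 - x) := by
  have hg0 : 0 < g := lt_of_lt_of_le hx0 hxg
  obtain ⟨p, w, hp, hw, hp1, hpx, hw0, hD, hγp, hρ₀, hγpos⟩ := windowPair_coords x g T l a h hx1 hg0 ha hlow hcomp hlight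
  obtain ⟨hlah, hDa, hgw, hden, hρ₁0, hρ₁x, h1γ₁, hdeep'⟩ :=
    windowPair_deep_gate₁ x g T p w l a h hx0 hx1 hxg hg1 hlow hcomp hlight hdeep hp hw
  rw [hγp] at hγ
  have hx1ne : (1 - x) ≠ 0 := ne_of_gt (by linarith)
  have hg1ne : (1 - g) ≠ 0 := ne_of_gt (by linarith)
  have hxne : x ≠ 0 := ne_of_gt hx0
  have hw2 : p - x ≤ w := by
    have : 1 ≤ (T + (a : ℝ) * g - 2 * (l : ℝ)) / ((h : ℝ) - l) := by rw [le_div_iff₀ hD]; linarith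
    linarith
  have key := WindowPairCert.poly_DX x g p w hx0.le (by linarith) (by linarith) (by linarith) (by linarith)
    (by linarith) (by linarith) (by linarith)
  rw [hγ]; nlinarith [key]

/-- **THE DEEP MID CASE** of the window pair with transfer: the union of cells D-A, D-B, D-C (the fourth case is empty by
`windowPair_deep_X`). [this work] -/
theorem windowPair_deep (x g T γ : ℝ) (j' M l a h : ℕ) (hx0 : 0 < x) (hx1 : x < 1) (hxg : x ≤ g) (hg1 : g < 1) (ha : 1 ≤ a)
    (hlaj : l + a ≤ j') (hlow : 2 * (l : ℝ) < T) (hjha : j' + 1 ≤ h + a) (hhj : h ≤ j') (hhM : h ≤ M) (hcomp : T < (l : ℝ) + h)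
    (hlight : T - 2 * (l : ℝ) < x * ((h : ℝ) - l)) (hmid : T + (a : ℝ) * g ≤ 2 * (h : ℝ))
    (hγ : γ = x ^ 2 + (1 - x) * ((T - 2 * (l : ℝ)) / ((h : ℝ) - l)))
    (hdeep : 2 * ((l : ℝ) + a) < T + (a : ℝ) * g) :
    ∃ t : ℝ, 0 ≤ t ∧ t * (1 - g) ≤ γ * g ∧
      DECAtT x (T + (a : ℝ) * g) j' (M + a) (fun k => (1 - γ) * (1 - g) * (if k = l then (1 : ℝ) else 0)
        + (1 - γ) * g * (if k = l + a then (1 : ℝ) else 0) + (γ * (1 - g) + t * (1 - g)) * (if k = h then (1 : ℝ) else 0)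
        + (γ * g - t * (1 - g)) * (if k = h + a then (1 : ℝ) else 0)) := by
  by_cases hlight0 : T + (a : ℝ) * g - 2 * (l : ℝ) < x * ((h : ℝ) - l)
  · exact windowPair_deep_A x g T γ j' M l a h hx0 hx1 hxg hg1 ha hlaj hlow hjha hhj hhM hcomp hlight hmid hγ hdeep hlight0
  · by_cases hside : (1 - γ) * (1 - g) * x ≤ γ * g * (1 - x)
    · exact windowPair_deep_B x g T γ j' M l a h hx0 hx1 hxg hg1 ha hlaj hlow hjha hhj hhM hcomp hlight hmid hγ hdeep
        (not_lt.1 hlight0) hside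
    · have hcompat0 : T + (a : ℝ) * g < (l : ℝ) + h := by
        by_contra hc
        exact hside (windowPair_deep_X x g T γ l a h hx0 hx1 hxg hg1 ha hlow hcomp hlight hγ hdeep (not_lt.1 hc))
      exact windowPair_deep_C x g T γ j' M l a h hx0 hx1 hxg hg1 ha hlaj hlow hjha hhj hhM hcomp hlight hmid hγ hdeep
        (not_lt.1 hlight0) hcompat0 (not_le.1 hside)

set_option maxHeartbeats 1600000 in
/-- **THE SHALLOW MID CASE** of the window pair with transfer (`T + ag ≤ 2(l+a)`): vertical block × cells S-A/S-B/S-C. [this work] -/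
theorem windowPair_shallow (x g T γ : ℝ) (j' M l a h : ℕ) (hx0 : 0 < x) (hx1 : x < 1) (hxg : x ≤ g) (hg1 : g < 1) (ha : 1 ≤ a)
    (hlaj : l + a ≤ j') (hlow : 2 * (l : ℝ) < T) (hjha : j' + 1 ≤ h + a) (hhj : h ≤ j') (hhM : h ≤ M) (hcomp : T < (l : ℝ) + h)
    (hlight : T - 2 * (l : ℝ) < x * ((h : ℝ) - l)) (hmid : T + (a : ℝ) * g ≤ 2 * (h : ℝ))
    (hγ : γ = x ^ 2 + (1 - x) * ((T - 2 * (l : ℝ)) / ((h : ℝ) - l)))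
    (hshallow : T + (a : ℝ) * g ≤ 2 * ((l : ℝ) + a)) :
    ∃ t : ℝ, 0 ≤ t ∧ t * (1 - g) ≤ γ * g ∧
      DECAtT x (T + (a : ℝ) * g) j' (M + a) (fun k => (1 - γ) * (1 - g) * (if k = l then (1 : ℝ) else 0)
        + (1 - γ) * g * (if k = l + a then (1 : ℝ) else 0) + (γ * (1 - g) + t * (1 - g)) * (if k = h then (1 : ℝ) else 0)
        + (γ * g - t * (1 - g)) * (if k = h + a then (1 : ℝ) else 0)) := by
  have hg0 : 0 < g := lt_of_lt_of_le hx0 hxg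
  have ha0 : (0 : ℝ) < a := by exact_mod_cast Nat.lt_of_lt_of_le Nat.zero_lt_one ha
  obtain ⟨p, w, hp, hw, hp1, hpx, hw0, hD, hγp, hρ₀, hγpos⟩ := windowPair_coords x g T l a h hx1 hg0 ha hlow hcomp hlight
  have hγ' : γ = 1 - (1 - x) * p := by rw [hγ, hγp]
  have h1γ : 0 ≤ 1 - γ := by
    rw [hγ']; have := mul_pos (sub_pos.2 hx1) (by linarith : (0:ℝ) < p); linarith
  have hxne : x ≠ 0 := ne_of_gt hx0
  have hx1ne : (1 - x) ≠ 0 := ne_of_gt (by linarith)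
  -- the cell conditions in coordinates
  have hsh' : 0 ≤ w * (2 - g) - g * (1 + x - p) := by
    have e : w * (2 - g) - g * (1 + x - p) = g * (2 * ((l : ℝ) + a) - (T + (a : ℝ) * g)) / ((h : ℝ) - l) := by
      rw [hw, hp]; field_simp; ring
    rw [e]; exact div_nonneg (mul_nonneg hg0.le (by linarith)) hD.le
  have hmid' : 0 ≤ 1 - x + p - w := by
    have e : 1 - x + p - w = (2 * (h : ℝ) - (T + (a : ℝ) * g)) / ((h : ℝ) - l) := by rw [hw, hp]; field_simp; ring
    rw [e]; exact div_nonneg (by linarith) hD.le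
  have hρw : 0 < 1 + x - p + w := by linarith
  -- the two possible vertical blocks, with the identity tying R to the coordinates
  have block : ∃ R lamv πa γv : ℝ, 0 ≤ R ∧ 0 ≤ lamv ∧ 0 ≤ πa ∧ (0 ≤ γv ∧ γv ≤ 1) ∧
      lamv * (1 - γv) = (1 - γ) * (1 - g) - R ∧ lamv * γv + πa = (1 - γ) * g ∧
      (0 < lamv → T + (a : ℝ) * g ≤ 2 * (l : ℝ) + (((l + a : ℕ) : ℝ) - (l : ℝ)) * (if x ≤ γv then γv else (γv - x ^ 2) / (1 - x))) ∧
      (0 < πa → T + (a : ℝ) * g ≤ 2 * ((l + a : ℕ) : ℝ)) ∧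
      ((R = (1 - x) * p * (1 - g) ∧ 0 ≤ g * (1 + x - p + w) - w) ∨
       (R * (1 + x - p + w) = (1 - x) * p * (1 + x - p) ∧ 0 ≤ w - g * (1 + x - p + w))) := by
    by_cases hvert : T + (a : ℝ) * g < 2 * (l : ℝ) + a
    · -- vertical pair compatible: γᵥ = ρᵥ = (T + ag − 2l)/a ∈ [g, 1), lamv = B/ρᵥ, πa = 0
      set ρv : ℝ := (T + (a : ℝ) * g - 2 * (l : ℝ)) / (a : ℝ) with hρv
      have hρvg : g < ρv := by rw [hρv, lt_div_iff₀ ha0]; linarith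
      have hρv1 : ρv < 1 := by rw [hρv, div_lt_one ha0]; linarith
      have hρv0 : 0 < ρv := lt_trans hg0 hρvg
      have hρvw : ρv * w = g * (1 + x - p + w) := by
        rw [hρv, hw, hp]; field_simp; ring
      refine ⟨(1 - γ) * (1 - g) - (1 - γ) * g / ρv * (1 - ρv), (1 - γ) * g / ρv, 0, ρv, ?_, ?_, le_rfl, ⟨hρv0.le, hρv1.le⟩,
        by ring, by rw [div_mul_cancel₀ _ hρv0.ne', add_zero], ?_, fun h0 => absurd h0 (lt_irrefl 0), Or.inr ⟨?_, ?_⟩⟩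
      · -- R ≥ 0 since ρᵥ ≥ g
        rw [hγ', sub_nonneg, div_mul_eq_mul_div, div_le_iff₀ hρv0]
        nlinarith [mul_pos (sub_pos.2 hx1) (by linarith : (0:ℝ) < p)]
      · exact div_nonneg (mul_nonneg h1γ hg0.le) hρv0.le
      · intro _
        rw [if_pos (hxg.trans hρvg.le), hρv]
        push_cast
        rw [show (l : ℝ) + a - l = a by ring, mul_div_cancel₀ _ ha0.ne']
        linarith
      · -- R (ρ + w) = (1-x) p ρ
        rw [hγ']
        have : ((1 - (1 - (1 - x) * p)) * (1 - g) - (1 - (1 - (1 - x) * p)) * g / ρv * (1 - ρv)) * (1 + x - p + w)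
            = (1 - x) * p * ((1 + x - p + w) - g * (1 + x - p + w) / ρv) := by
          field_simp; ring
        rw [this, ← hρvw, mul_div_cancel_left₀ _ hρv0.ne']
        ring
      · have e : w - g * (1 + x - p + w) = g * (2 * (l : ℝ) + a - (T + (a : ℝ) * g)) / ((h : ℝ) - l) := by
          rw [hw, hp]; field_simp; ring
        rw [e]; exact div_nonneg (mul_nonneg hg0.le (by linarith)) hD.le
    · -- no vertical pair: R = A, πa = B
      refine ⟨(1 - γ) * (1 - g), 0, (1 - γ) * g, 0, ?_, le_rfl, ?_, ⟨le_rfl, zero_le_one⟩, by ring, by ring,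
        fun h0 => absurd h0 (lt_irrefl 0), fun _ => by push_cast; exact hshallow, Or.inl ⟨by rw [hγ']; ring, ?_⟩⟩
      · exact mul_nonneg h1γ (by linarith)
      · exact mul_nonneg h1γ hg0.le
      · have e : g * (1 + x - p + w) - w = g * (T + (a : ℝ) * g - (2 * (l : ℝ) + a)) / ((h : ℝ) - l) := by
          rw [hw, hp]; field_simp; ring
        rw [e]; exact div_nonneg (mul_nonneg hg0.le (by linarith)) hD.le
  obtain ⟨R, lamv, πa, γv, hR0, hlamv, hπa, hγv, hbalv1, hbalv2, hvalv, hvala, hRid⟩ := block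
  -- the cells
  by_cases hlight0 : T + (a : ℝ) * g - 2 * (l : ℝ) < x * ((h : ℝ) - l)
  · -- S-A
    refine windowPair_shallow_A x g T γ R lamv πa γv j' M l a h hx0 hx1 hxg hg1 ha hlaj hlow hjha hhj hhM hcomp hlight hmid hγ
      hR0 hlamv hπa hγv hbalv1 hbalv2 hvalv hvala hlight0 ?_
    have hw1 : w < p - 1 := by
      have : (T + (a : ℝ) * g - 2 * (l : ℝ)) / ((h : ℝ) - l) < x := by rw [div_lt_iff₀ hD]; linarith
      linarith
    rw [hρ₀, show 1 + x - (1 + x - p + w) = p - w by ring]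
    have hpos : 0 < (1 - x) * (p - w) := mul_pos (by linarith) (by linarith)
    rw [div_le_iff₀ hpos, hγ']
    rcases hRid with ⟨hR, hnov⟩ | ⟨hR, hver⟩
    · rw [hR]
      have key := WindowPairCert.poly_SAn x g p w hx0.le (by linarith) hg0.le (by linarith) (by linarith) (by linarith)
        (by linarith) (by linarith) hw0.le (by linarith) (by linarith) (by linarith) (by linarith) (by linarith)
      nlinarith [key]
    · have key := WindowPairCert.poly_SAv x p w hx0.le (by linarith) (by linarith) hw0.le (by linarith) (by linarith)
      refine le_of_mul_le_mul_right ?_ hρw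
      have e : R * (1 + x - p + w) = (1 - x) * p * (1 + x - p) := hR
      nlinarith [key, e]
  · by_cases hside : R * x ≤ γ * g * (1 - x)
    · -- S-B
      exact windowPair_shallow_B x g T γ R lamv πa γv j' M l a h hx0 hx1 hxg hg1 ha hlaj hlow hjha hhj hhM hcomp hlight hmid hγ
        hR0 hlamv hπa hγv hbalv1 hbalv2 hvalv hvala hside
    · -- S-C; the incompatible case is empty
      have hcompat0 : T + (a : ℝ) * g < (l : ℝ) + h := by
        by_contra hc
        apply hside
        have hw2 : p - x ≤ w := by
          have : 1 ≤ (T + (a : ℝ) * g - 2 * (l : ℝ)) / ((h : ℝ) - l) := by rw [le_div_iff₀ hD]; linarith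
          linarith
        rcases hRid with ⟨hR, hnov⟩ | ⟨hR, hver⟩
        · rw [hR, hγ']
          have key := windowPair_SXn x g p w hx0.le hx1.le hxg hg1.le hw2 (by linarith)
          nlinarith [key]
        · have key := WindowPairCert.poly_SXv x g p w hx0.le (by linarith) hg0.le (by linarith) (by linarith) (by linarith)
            (by linarith)
          refine le_of_mul_le_mul_right ?_ hρw
          rw [hγ']
          have e : R * (1 + x - p + w) = (1 - x) * p * (1 + x - p) := hR
          nlinarith [key, e]
      refine windowPair_shallow_C x g T γ R lamv πa γv j' M l a h hx0 hx1 hxg ha hlaj hlow hjha hhj hhM hcomp hlight hmid hγ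
        hlamv hπa hγv hbalv1 hbalv2 hvalv hvala (not_lt.1 hlight0) hcompat0 (not_le.1 hside) ?_
      have hw1 : p - 1 ≤ w := by
        have : x ≤ (T + (a : ℝ) * g - 2 * (l : ℝ)) / ((h : ℝ) - l) := by rw [le_div_iff₀ hD]; linarith
        linarith
      have hw2 : w < p - x := by
        have : (T + (a : ℝ) * g - 2 * (l : ℝ)) / ((h : ℝ) - l) < 1 := by rw [div_lt_one hD]; linarith
        linarith
      rw [hρ₀]
      have h1ρ₀ : 0 < 1 - (1 + x - p + w) := by linarith
      rw [div_le_iff₀ h1ρ₀, show R - γ * g * (1 - x) / x = (R * x - γ * g * (1 - x)) / x by field_simp,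
        div_mul_eq_mul_div, div_le_iff₀ hx0, hγ']
      rcases hRid with ⟨hR, hnov⟩ | ⟨hR, hver⟩
      · rw [hR]
        have key := WindowPairCert.poly_SCn x g p w hx0.le (by linarith) (by linarith) (by linarith) (by linarith) (by linarith)
          (by linarith) (by linarith [hnov])
        nlinarith [key]
      · have key := WindowPairCert.poly_SCv x g p w hx0.le (by linarith) (by linarith) (by linarith) hw0.le (by linarith)
          (by linarith) (by linarith)
        refine le_of_mul_le_mul_right ?_ hρw
        have e : R * (1 + x - p + w) = (1 - x) * p * (1 + x - p) := hR
        have e2 : R * (1 + x - p + w) * (x * (1 + x - p + w)) = (1 - x) * p * (1 + x - p) * (x * (1 + x - p + w)) := by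
          rw [e]
        nlinarith [key, e2]

/-- **THE MID CASE OF THE WINDOW PAIR WITH TRANSFER (`h′ = h`).**  For `0 < x < 1`, `x ≤ g < 1`, `a ≥ 1`, a low `l` (`2l < T`), a
LIGHT window absorber `h` (`T < l + h`, `T − 2l < x(h − l)`, `l + a ≤ j′`, `h ≤ j′ < h + a`, `h ≤ M`) and `T + ag ≤ 2h`, there is a
transfer `0 ≤ t(1−g) ≤ γg` (`γ = x² + (1−x)(T−2l)/(h−l)`) such that
`(1−γ)(1−g)δ_l + (1−γ)gδ_{l+a} + (γ(1−g) + t(1−g))δ_h + (γg − t(1−g))δ_{h+a}` is `DECAtT x (T + ag) j′ (M + a)`. [this work] -/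
theorem windowPair_mid (x g T γ : ℝ) (j' M l a h : ℕ) (hx0 : 0 < x) (hx1 : x < 1) (hxg : x ≤ g) (hg1 : g < 1) (ha : 1 ≤ a)
    (hlaj : l + a ≤ j') (hlow : 2 * (l : ℝ) < T) (hjha : j' + 1 ≤ h + a) (hhj : h ≤ j') (hhM : h ≤ M) (hcomp : T < (l : ℝ) + h)
    (hlight : T - 2 * (l : ℝ) < x * ((h : ℝ) - l)) (hmid : T + (a : ℝ) * g ≤ 2 * (h : ℝ))
    (hγ : γ = x ^ 2 + (1 - x) * ((T - 2 * (l : ℝ)) / ((h : ℝ) - l))) :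
    ∃ t : ℝ, 0 ≤ t ∧ t * (1 - g) ≤ γ * g ∧
      DECAtT x (T + (a : ℝ) * g) j' (M + a) (fun k => (1 - γ) * (1 - g) * (if k = l then (1 : ℝ) else 0)
        + (1 - γ) * g * (if k = l + a then (1 : ℝ) else 0) + (γ * (1 - g) + t * (1 - g)) * (if k = h then (1 : ℝ) else 0)
        + (γ * g - t * (1 - g)) * (if k = h + a then (1 : ℝ) else 0)) := by
  by_cases hdeep : 2 * ((l : ℝ) + a) < T + (a : ℝ) * g
  · exact windowPair_deep x g T γ j' M l a h hx0 hx1 hxg hg1 ha hlaj hlow hjha hhj hhM hcomp hlight hmid hγ hdeep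
  · exact windowPair_shallow x g T γ j' M l a h hx0 hx1 hxg hg1 ha hlaj hlow hjha hhj hhM hcomp hlight hmid hγ (not_lt.1 hdeep)

end LawDec

end Quant

end Summit.CriticalPhenomena.PercolationContinuityZ3.Theorems
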